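import Mathlib
import HarnessLib
import Summits.ResolutionOfSingularities.ResolutionOfSingularities.Theorems.WildQuotientsWildQuotientResolutionS1aMoveResidual
import Summits.ResolutionOfSingularities.ResolutionOfSingularities.Theorems.WildQuotientsWildQuotientResolutionS1aAuxCover

/-!
# S1a — X-scheme MOVE ATLAS on a realisation, for an ARBITRARY node: the σ-fixed norm charts, their EXPOSED pinned nodes, and the formal-locus bound

[OURS · L1 W4.5c · lead-1 g12; plan-1 A-KF v1 §3.2 (producer charts + restricted old charts), R-F15b (6), R-F15c (I-2 := MT-a1″: three moves, 2 + 2 + 3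
producer charts), X-CERT v1 §4 N3/N4] — NOT statements of the manuscript; counted 0; AI-level work, weaker than expert review. Crux
stmt-ResolutionOfSingularities-17941 `CyclicQuotientFourfolds`, line `s1a-logminvertex` v13 (`stub_reachLowerInFX`).

The node-generic form of what `a1_move1_atlas` (✓p669543) did inline for the root: `M` a model with an atlas `𝔄`, `W` a stable affine chart with an
EXPLICIT node `(B, 𝒜, σ, e)` and a K1′-regular σ-adapted homogeneous weighted centre `(f, w)` in `B`, `𝒦` a `G`-stable centre of Veronese degree `d`
with `(𝒦|W)_n = e⁻¹(trace 𝒥ₙ)` and `supp 𝒦_d ⊆ W` (✓`exists_isAdmissibleCentre_of_modelNode` / ✓p663025), `π′ : M′ → M` a realisation, `k > 0`, a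
σ-fixed cover `y_j ∈ K_{dk}` with the radical condition, (H1) `aug σ_R ≤ (g)` on `R^w`, and on each chart finitely many degree-0 RESIDUAL elements
`z_{j,l} ∈ 𝔞·ChartRing_j` (`𝔞 = (aug σ_R : g)`):
* ★★ `exists_moveAtlas_of_node` — there are stable affine producer charts `O′_j = M′[W, e⁻¹y_j]` covering `π′⁻¹W`, EXPOSED pinned node isomorphisms
  `E_j : Γ(M′, O′_j) ≃ (ChartRing_j)₀` (tame, `g₀`-intertwining, `E_j(π′^*x) = toChartRing (e x)` — ✓p661308), and an atlas `𝔄′` on `M′` with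
  `F_𝔄′ ⊆ π′⁻¹(F_𝔄 ∖ W) ∪ ⋃_j (O′_j ∩ V(E_j⁻¹ z_{j,·}))`.
The exposed `E_j` are what the NEXT move consumes (its node is `(ChartRing_j, chartNodeGrading, sigmaChart, E_j)`, modelled by `NodeData.map`).
-/

set_option linter.dupNamespace false

noncomputable section

open CategoryTheory Limits AlgebraicGeometry TopologicalSpace Topology Opposite
open Literature.AlgebraicGeometry.Resolution Literature.AlgebraicGeometry.RelativeSpec
open Summit.ResolutionOfSingularities.ResolutionOfSingularities.Theorems.WildQuotientResolution.S1
open Summit.ResolutionOfSingularities.ResolutionOfSingularities.Theorems.WildQuotientResolution.S1.NodeAtlas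
open Summit.ResolutionOfSingularities.ResolutionOfSingularities.Theorems.WildQuotientResolution.S1.CoarseChart
open Summit.ResolutionOfSingularities.ResolutionOfSingularities.Theorems.WildQuotientResolution.S1.ProducerStep
open Summit.ResolutionOfSingularities.ResolutionOfSingularities.Theorems.WildQuotientResolution.S1.NpFrame
open Summit.ResolutionOfSingularities.ResolutionOfSingularities.Theorems.WildQuotientResolution.S1.GoodCharts
open Summit.ResolutionOfSingularities.ResolutionOfSingularities.Theorems.WildQuotientResolution.S1.BlowupCharts
open Summit.ResolutionOfSingularities.ResolutionOfSingularities.Theorems.WildQuotientResolution.S1.KillableTransport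
open Summit.ResolutionOfSingularities.ResolutionOfSingularities.Theorems.WildQuotientResolution.S1.KillCert
open Summit.ResolutionOfSingularities.ResolutionOfSingularities.Theorems.WildQuotientResolution.BlowupExit

namespace Summit.ResolutionOfSingularities.ResolutionOfSingularities.Theorems.WildQuotientResolution.S1.GameFrame.GModel

variable {p : ℕ} {X' X₁ : Scheme.{0}} {q : X' ⟶ X₁} {G : Type} [Group G] {ρ : G →* Aut X'} {g₀ : G}

set_option maxHeartbeats 1600000 in
/-- ★★ **THE MOVE ATLAS ON A REALISATION, FOR AN ARBITRARY NODE, WITH EXPOSED PRODUCER NODES.** See the module docstring.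
[OURS · L1 W4.5c · X-scheme MOVE (atlas half); NOT a statement of the manuscript] -/
theorem exists_moveAtlas_of_node [Finite G] (hp : 0 < p) (hG : ∀ g : G, g ∈ Subgroup.zpowers g₀) (M M' : GModel p q G ρ g₀)
    (𝔄 : NodeAtlasData p M.act g₀) (W : M.act.StableAffineOpens) (hW : IsAffineOpen W.1)
    {m : ℕ} (r : Fin m → ℕ) {B : Type} [CommRing B] (𝒜 : (Π j : Fin m, ZMod (r j)) → AddSubgroup B) [GradedRing 𝒜] {c : ℕ}
    (f : Fin c → B) {δ : Fin c → Π j : Fin m, ZMod (r j)} (w : Fin c → ℕ) (hf : ∀ i, f i ∈ 𝒜 (δ i))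
    (σ : B ≃+* B) (e : Γ(M.V, W.1) ≃+* ↥(𝒜 0)) (htame : IsTameNode p B 𝒜 σ) (hσp : ∀ x : B, (⇑σ)^[p] x = x)
    (hσ : ∀ t : Γ(M.V, W.1), ((e ((M.act.aut g₀⁻¹).hom.appLE W.1 W.1 (W.2.1 g₀⁻¹).ge t) : ↥(𝒜 0)) : B) = σ ((e t : ↥(𝒜 0)) : B))
    (hw : ∀ i, 0 < w i) (hK1 : RingTheory.Sequence.IsRegular B (List.ofFn f)) (hK1' : IsRegularRing (B ⧸ Ideal.span (Set.range f)))
    (hσJ : ∀ n : ℕ, ((weightedFiltration f w).ideal n).map (σ : B →+* B) ≤ (weightedFiltration f w).ideal n)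
    (𝒦 : ReesFiltration M.V) (d : ℕ) (h𝒦G : ∀ (g : G) (n : ℕ), (𝒦.ideal n).comap (M.act.aut g).hom = 𝒦.ideal n)
    (h𝒦O : ∀ n, (𝒦.filtration ⟨W.1, hW⟩).ideal n = ((traceFiltration 𝒜 f w).ideal n).comap (e : Γ(M.V, W.1) →+* ↥(𝒜 0)))
    (hver : VeroneseNormalised 𝒜 f w d) (hsuppW : (((𝒦.ideal d).support : Set M.V)) ⊆ (W.1 : Set M.V))
    (π' : M'.V ⟶ M.V) (hbl : IsBlowup π' (𝒦.ideal d)) (hr : M'.r = π' ≫ M.r)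
    (hcomm : ∀ g : G, (M'.act.aut g).hom ≫ π' = π' ≫ (M.act.aut g).hom)
    {k : ℕ} (hk : 0 < k) {L : ℕ} (y : Fin L → ↥(𝒜 0)) (hy : ∀ j, y j ∈ (traceFiltration 𝒜 f w).ideal (d * k)) (hσy : ∀ j, σ (y j : B) = y j)
    (hrad : ∀ i : Fin c, cobordantAlgebra.u' f w i ∈ (Ideal.span (Set.range fun j => coverElement 𝒜 f w (d * k) (y j) (hy j))).radical)
    (g : ↥(cobordantAlgebra f w)) (h1 : augmentationIdeal (sigmaR σ f w hσJ hp hσp) ≤ Ideal.span {g})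
    (n : Fin L → ℕ) (z : ∀ j, Fin (n j) → ChartRing 𝒜 f w (d * k) (y j) (hy j))
    (hz0 : ∀ j l, z j l ∈ chartNodeGrading r 𝒜 f w hf (d * k) (y j) (hy j) 0)
    (hzres : ∀ j l, z j l ∈ ((augmentationIdeal (sigmaR σ f w hσJ hp hσp)).colon (Ideal.span {g})).map (algebraMap _ (ChartRing 𝒜 f w (d * k) (y j) (hy j)))) :
    ∃ (O' : Fin L → M'.act.StableAffineOpens) (_ : ∀ j, IsAffineOpen (O' j).1)
      (_ : ∀ j, (O' j).1 = blowupChart π' ((𝒦.ideal d) ^ k) ⟨W.1, hW⟩ (e.symm (y j)))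
      (E : ∀ j, letI := chartNodeGradedRing r 𝒜 f w hf (d * k) (y j) (hy j); Γ(M'.V, (O' j).1) ≃+* ↥(chartNodeGrading r 𝒜 f w hf (d * k) (y j) (hy j) 0)),
      (∀ j, letI := chartNodeGradedRing r 𝒜 f w hf (d * k) (y j) (hy j);
        IsTameNode p (ChartRing 𝒜 f w (d * k) (y j) (hy j)) (chartNodeGrading r 𝒜 f w hf (d * k) (y j) (hy j))
          (sigmaChart 𝒜 f w (d * k) (y j) (hy j) σ hσJ hp hσp (hσy j))) ∧
      (∀ j, letI := chartNodeGradedRing r 𝒜 f w hf (d * k) (y j) (hy j); ∀ t' : Γ(M'.V, (O' j).1),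
        ((E j ((M'.act.aut g₀⁻¹).hom.appLE (O' j).1 (O' j).1 ((O' j).2.1 g₀⁻¹).ge t') : ↥(chartNodeGrading r 𝒜 f w hf (d * k) (y j) (hy j) 0)) :
            ChartRing 𝒜 f w (d * k) (y j) (hy j)) =
          sigmaChart 𝒜 f w (d * k) (y j) (hy j) σ hσJ hp hσp (hσy j)
            ((E j t' : ↥(chartNodeGrading r 𝒜 f w hf (d * k) (y j) (hy j) 0)) : ChartRing 𝒜 f w (d * k) (y j) (hy j))) ∧
      (∀ j (hle : (O' j).1 ≤ π' ⁻¹ᵁ W.1) (x : Γ(M.V, W.1)), letI := chartNodeGradedRing r 𝒜 f w hf (d * k) (y j) (hy j);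
        ((E j (π'.appLE W.1 (O' j).1 hle x) : ↥(chartNodeGrading r 𝒜 f w hf (d * k) (y j) (hy j) 0)) : ChartRing 𝒜 f w (d * k) (y j) (hy j)) =
          toChartRing 𝒜 f w (d * k) (y j) (hy j) (e x)) ∧
      ∃ 𝔄' : NodeAtlasData p M'.act g₀,
        𝔄'.fLocus ⊆ π'.base ⁻¹' (𝔄.fLocus \ (W.1 : Set M.V)) ∪
          ⋃ j, ((O' j).1 : Set M'.V) ∩ {v | ∀ l, letI := chartNodeGradedRing r 𝒜 f w hf (d * k) (y j) (hy j);
            v ∉ M'.V.basicOpen ((E j).symm ⟨z j l, hz0 j l⟩)} := by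
  classical
  have hk0 : k ≠ 0 := hk.ne'
  have hverbar : VeroneseNormalised 𝒜 f w (d * k) := CoarseChart.veroneseNormalised_mul 𝒜 _ _ hver hk
  have hπ' : IsBlowup π' ((𝒦.ideal d) ^ k) := isBlowup_pow hbl hk0
  have hJ' : ((𝒦.ideal d) ^ k).ideal ⟨W.1, hW⟩ = ((traceFiltration 𝒜 f w).ideal (d * k)).comap (e : Γ(M.V, W.1) →+* ↥(𝒜 0)) := by
    rw [Scheme.IdealSheafData.ideal_pow, Pi.pow_apply, ← ReesFiltration.filtration_ideal, h𝒦O d, hver.2 k, comap_equiv_pow]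
  -- the producer charts
  have hxJ : ∀ j, e.symm (y j) ∈ ((𝒦.ideal d) ^ k).ideal ⟨W.1, hW⟩ := fun j => by
    rw [hJ', Ideal.mem_comap, RingHom.coe_coe, e.apply_symm_apply]; exact hy j
  have hfix : ∀ (j) (g : G), (M.act.aut g).hom.appLE W.1 W.1 (W.2.1 g).ge (e.symm (y j)) = e.symm (y j) := fun j g => by
    have hfix₀ : (M.act.aut g₀⁻¹).hom.appLE W.1 W.1 (W.2.1 g₀⁻¹).ge (e.symm (y j)) = e.symm (y j) := by
      apply e.injective
      apply Subtype.ext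
      rw [hσ (e.symm (y j)), e.apply_symm_apply]
      exact hσy j
    exact appLE_aut_eq_self_of_mem_zpowers M.act W.1 W.2.1 hfix₀ (by rw [Subgroup.zpowers_inv]; exact hG g)
  have hρk : ∀ g : G, ((𝒦.ideal d) ^ k).comap (M.act.aut g).hom = (𝒦.ideal d) ^ k := fun g => by
    rw [comap_pow]; exact congrArg (· ^ k) (h𝒦G g d)
  have hWex : ∀ j, ∃ O' : M'.act.StableAffineOpens, O'.1 = blowupChart π' ((𝒦.ideal d) ^ k) ⟨W.1, hW⟩ (e.symm (y j)) ∧ IsAffineOpen O'.1 := fun j =>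
    exists_stable_blowupChart M.act hπ' M'.act hr hcomm hρk W hW (e.symm (y j)) (hxJ j) (hfix j)
  choose OW hOWeq hOWaff using hWex
  have hnode := fun j => exists_nodeData_blowupChart_pin M.act M'.act hcomm g₀ r 𝒜 f w hf hp W hW σ e htame hσp hσ hw hK1 hK1' hσJ hπ' hverbar hJ'
    (y j) (hy j) (hσy j) (OW j) (hOWeq j)
  choose E htame' hE hpin using hnode
  -- the literal nodes and their residual sets
  obtain ⟨DW, hDWdef⟩ : ∃ DW : ∀ j, NodeData p M'.act g₀ (OW j), DW = fun j =>
      letI := chartNodeGradedRing r 𝒜 f w hf (d * k) (y j) (hy j)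
      { affine := hOWaff j, m := m + 1, r := Fin.cons 0 r, B := ChartRing 𝒜 f w (d * k) (y j) (hy j),
        𝒜 := chartNodeGrading r 𝒜 f w hf (d * k) (y j) (hy j),
        σ := sigmaChart 𝒜 f w (d * k) (y j) (hy j) σ hσJ hp hσp (hσy j),
        e := E j, tame := htame' j, intertwine := hE j } := ⟨_, rfl⟩
  let R : Fin L → Set M'.V := fun j => {v | ∀ l, letI := chartNodeGradedRing r 𝒜 f w hf (d * k) (y j) (hy j);
    v ∉ M'.V.basicOpen ((E j).symm ⟨z j l, hz0 j l⟩)}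
  have hDW : ∀ j, ∀ v ∈ (OW j).1, v ∉ R j → (DW j).PrincipalNear v := by
    intro j v _ hRv
    rw [hDWdef]
    simp only [R, Set.mem_setOf_eq, not_forall, not_not] at hRv
    obtain ⟨l, hvl⟩ := hRv
    exact principalNear_producerChart_of_mem_residual hG (OW j) (hOWaff j) (E j) (htame' j) (hE j) h1 ⟨_, hz0 j l⟩ (hzres j l) hvl
  -- the charts cover `π′⁻¹ W`
  have hcovW := iSup_blowupChart_eq_preimage (I := 𝒦.ideal d) M.act r 𝒜 f w hf W hW e hπ' hverbar hJ' y hy hrad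
  have hcov : ∀ v' : M'.V, π'.base v' ∈ (W.1 : Set M.V) → ∃ j, v' ∈ (OW j).1 := fun v' hv => by
    have hv'W : v' ∈ ⨆ j, blowupChart π' ((𝒦.ideal d) ^ k) ⟨W.1, hW⟩ (e.symm (y j)) := by rw [hcovW]; exact hv
    obtain ⟨j, hj⟩ := Opens.mem_iSup.mp hv'W
    exact ⟨j, by rw [hOWeq j]; exact hj⟩
  obtain ⟨𝔄', hF⟩ := exists_moveAtlas_of_nodeData M M' 𝔄 𝒦 d (fun g => h𝒦G g d) π' hbl hr hcomm (W.1 : Set M.V) hsuppW OW DW hcov R hDW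
  exact ⟨OW, hOWaff, hOWeq, E, htame', hE, hpin, 𝔄', hF⟩

end Summit.ResolutionOfSingularities.ResolutionOfSingularities.Theorems.WildQuotientResolution.S1.GameFrame.GModel

end
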